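import Summits.CriticalPhenomena.CardyFormulaZ2.Theorems.CardyMagicRigidityNestingRigidityNeckZ2SkeletonSlots
import Summits.CriticalPhenomena.CardyFormulaZ2.Theorems.CardyMagicRigidityNestingRigidityNeckZ2NodeReimerRegion
import HarnessLib

/-!
# Crux `NestingRigidity`, line `pinch-resampling` (v4), stub S12: the skeleton event and its probability

Crux `Summit.CriticalPhenomena.CardyFormulaZ2.Theses.CardyMagicRigidity.NestingRigidity`
(stmt-CriticalPhenomena-4835), line `pinch-resampling` v4, stub S12 `stub_neckHookupCoarseZ2 : NeckHookupCoarseZ2`.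
First ASSEMBLY brick of the summation of the necklace bound `ZNodeAbsBoundChainA` (amended plan in the module
docstring of `…NestingRigidityGapEntropy`, worker W6a): the event `E_σ` attached to a skeleton and its probability.

* §1 `NeckCoarseZ2.SkelData` — raw skeleton data (cut `a₀`, number of cells `n`, gaps `g`, arm cells `A`, claimed
  slots `Z`); `SkelData.t` (partial sums), `SkelData.Valid Nc` (the axioms of a cell skeleton), and
  `SkelData.toCellSkeleton` (`…NeckZ2SkeletonCells`).
* §2 `CellSkeleton.goodNodes` — the CERTIFIED nodes: index intervals `[i, j]` which are nodes of the gap hierarchy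
  (`GapHierarchy.IsNode`, `…GapHierarchy`) with `M (Δ + 1) ≤ G` (`Δ = t j - t i`, `G = gapOutZ`) and outer radius
  `ℓ ⌊G/8⌋ ≤ s - 1`; `CellSkeleton.armIndex A Z Jz` — the claimed arms `(m, z)`, `m ∈ A`, `z ∈ Z m`, `z < Jz`.
* §3 `CellSkeleton.skelEvent` — the event of the glued bound `real_fourArm_and_armsIn_le` (`…NeckZ2NodeReimerRegion`)
  for the node annuli of the good nodes (`…NeckZ2NodeAnnuli`) and the arm annuli of the claimed arms
  (`…NeckZ2SkeletonArms`), inside `Λ_{2s}(x)`; `SkelData.skelEvent` — the same guarded by validity.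
* §4 `CellSkeleton.real_skelEvent_le` (registered anchor `skeleton_event_bound`): for `M ≥ 48`, `R₀ ≥ 2`, `K ≥ 1`,
  `P(skelEvent) ≤ (∏_good c (rIn/ROut)^{1+ε}) · ∏_arms C (armRIn/(armROut - 1))^α` — all hypotheses of the glue
  (radii, containment, pairwise disjointness of the good annuli by laminarity + `nodeAnnulus_disjoint`) hold.

Remaining for `ZNodeAbsBoundChainA` (next bricks): the COVERING `ZNodeEventChainA ∩ {lattice} ⊆ ⋃_{σ admissible}
skelEvent σ` (normal form `Necklace`, `exists_cellSkeleton`, `exists_armCells`, `node_crossings`, `arm_harm/hdist/havoid`,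
free slots `skeleton_free_slots` + `cellSkeleton_blocked_slots`), and the SUM over admissible skeletons
(`gapEntropy_le`, `sum_rpow_neg_le`, accounting of the plan).
-/

noncomputable section

namespace Summit.CriticalPhenomena.CardyFormulaZ2.Cruxes.NestingRigidity.PinchResampling

open MeasureTheory Set Literature.Probability.Percolation Literature.Probability.LatticeModels
open ZPinchLocality Finset
open NeckCoarseZ2

namespace NeckCoarseZ2

/-! ## §1 Raw skeleton data -/

/-- **Raw skeleton data**: cut, number of occupied cells, gaps between consecutive rotated cells, arm cells, claimed
slots per cell (junk values beyond the meaningful ranges). -/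
structure SkelData where
  /-- The cut (a cell index). -/
  a₀ : ℤ
  /-- The number of occupied cells. -/
  n : ℕ
  /-- The gaps between consecutive rotated cells (`g m` for `m + 1 < n`). -/
  g : ℕ → ℤ
  /-- The arm cells. -/
  A : Finset ℕ
  /-- The claimed slots of each cell. -/
  Z : ℕ → Finset ℕ

namespace SkelData

variable (d : SkelData)

/-- The rotated cells: partial sums of the gaps. -/
def t (m : ℕ) : ℤ := ∑ m' ∈ range m, d.g m'

/-- **Validity** with `Nc` cells: the axioms of a cell skeleton. -/
def Valid (Nc : ℤ) : Prop :=
  0 ≤ d.a₀ ∧ d.a₀ < Nc ∧ 1 ≤ d.n ∧ (∀ m, m + 1 < d.n → 1 ≤ d.g m) ∧ d.t (d.n - 1) < Nc ∧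
    ∀ m, m + 1 < d.n → d.g m ≤ Nc - d.t (d.n - 1)

/-- `t (m + 1) = t m + g m`. -/
theorem t_succ (m : ℕ) : d.t (m + 1) = d.t m + d.g m := by
  simp [t, sum_range_succ]

/-- The rotated cells of valid data increase. -/
theorem t_mono {Nc : ℤ} (h : d.Valid Nc) {m m' : ℕ} (hm : m ≤ m') (hm' : m' < d.n) : d.t m ≤ d.t m' := by
  induction m' with
  | zero =>
    obtain rfl : m = 0 := Nat.le_zero.1 hm
    exact le_rfl
  | succ k ih =>
    rcases hm.eq_or_lt with rfl | hlt
    · exact le_rfl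
    · have h1 := ih (Nat.lt_succ_iff.1 hlt) (by omega)
      have h2 := h.2.2.2.1 k hm'
      rw [d.t_succ]
      omega

/-- **The cell skeleton of valid data.** -/
def toCellSkeleton {Nc : ℤ} (h : d.Valid Nc) : CellSkeleton Nc where
  a₀ := d.a₀
  n := d.n
  t := d.t
  a₀_nonneg := h.1
  a₀_lt := h.2.1
  one_le := h.2.2.1
  t_zero := by simp [t]
  t_lt_succ m hm := by
    have := h.2.2.2.1 m hm
    rw [d.t_succ]
    omega
  t_lt m hm := lt_of_le_of_lt (d.t_mono h (by omega) (by have := h.2.2.1; omega)) h.2.2.2.2.1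
  wrap m hm := by
    have := h.2.2.2.2.2 m hm
    rw [d.t_succ]
    omega

end SkelData

namespace CellSkeleton

variable {Nc : ℤ} (S : CellSkeleton Nc)

/-! ## §2 Good nodes and claimed arms -/

open scoped Classical in
/-- **The certified (good) nodes**: nodes `[i, j]` of the gap hierarchy of the rotated cells with
`M (Δ + 1) ≤ G` and `ℓ ⌊G/8⌋ + 1 ≤ s`. -/
def goodNodes (ℓ s : ℕ) (M Groot : ℤ) : Finset (ℕ × ℕ) :=
  (range S.n ×ˢ range S.n).filter fun q ↦ q.1 ≤ q.2 ∧
    GapHierarchy.IsNode (S.n - 1) (fun m ↦ (S.gapZ Groot m : ℝ)) q.1 q.2 ∧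
    M * (S.t q.2 - S.t q.1 + 1) ≤ S.gapOutZ Groot q.1 q.2 ∧ (ℓ : ℤ) * (S.gapOutZ Groot q.1 q.2 / 8) + 1 ≤ s

/-- **The claimed arms** `(m, z)`: `m ∈ A`, `z ∈ Z m`, `z < Jz`. -/
def armIndex (A : Finset ℕ) (Z : ℕ → Finset ℕ) (Jz : ℕ) : Finset (ℕ × ℕ) :=
  (A ×ˢ range Jz).filter fun p ↦ p.2 ∈ Z p.1

/-- Membership in the good nodes. -/
theorem mem_goodNodes {ℓ s : ℕ} {M Groot : ℤ} {q : ℕ × ℕ} :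
    q ∈ S.goodNodes ℓ s M Groot ↔ q.1 ≤ q.2 ∧ q.2 < S.n ∧
      GapHierarchy.IsNode (S.n - 1) (fun m ↦ (S.gapZ Groot m : ℝ)) q.1 q.2 ∧
      M * (S.t q.2 - S.t q.1 + 1) ≤ S.gapOutZ Groot q.1 q.2 ∧ (ℓ : ℤ) * (S.gapOutZ Groot q.1 q.2 / 8) + 1 ≤ s := by
  classical
  simp only [goodNodes, mem_filter, mem_product, Finset.mem_range]
  constructor
  · rintro ⟨⟨-, h2⟩, h3, h4, h5, h6⟩
    exact ⟨h3, h2, h4, h5, h6⟩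
  · rintro ⟨h3, h2, h4, h5, h6⟩
    exact ⟨⟨lt_of_le_of_lt h3 h2, h2⟩, h3, h4, h5, h6⟩

/-! ## §3 The skeleton event -/

/-- **The skeleton event**: the event of `real_fourArm_and_armsIn_le` for the good node annuli and the claimed arm
annuli, inside `Λ_{2s}(x)`. -/
def skelEvent (ℓ s : ℕ) (x : Site 2) (M Groot : ℤ) (R₀ K Jz : ℕ) (A : Finset ℕ) (Z : ℕ → Finset ℕ) :
    Set (BondConfig (Site 2)) :=
  {ω | ∃ (p₁ q₁ p₂ q₂ : ℕ × ℕ → Site 2) (c : ℕ × ℕ → Site 2),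
    (∀ a ∈ S.goodNodes ℓ s M Groot,
      zNorm (p₁ a - S.nodeCenter ((s : ℤ) + 1) ℓ x a.1) = S.nodeRIn ℓ a.1 a.2 ∧
      zNorm (q₁ a - S.nodeCenter ((s : ℤ) + 1) ℓ x a.1) = nodeROut ℓ (S.gapOutZ Groot a.1 a.2) ∧
      zNorm (p₂ a - S.nodeCenter ((s : ℤ) + 1) ℓ x a.1) = S.nodeRIn ℓ a.1 a.2 ∧
      zNorm (q₂ a - S.nodeCenter ((s : ℤ) + 1) ℓ x a.1) = nodeROut ℓ (S.gapOutZ Groot a.1 a.2) ∧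
      PathIn (openGraph ω) (zAnn (S.nodeCenter ((s : ℤ) + 1) ℓ x a.1) (S.nodeRIn ℓ a.1 a.2)
        (nodeROut ℓ (S.gapOutZ Groot a.1 a.2))) (p₁ a) (q₁ a) ∧
      PathIn (openGraph ω) (zAnn (S.nodeCenter ((s : ℤ) + 1) ℓ x a.1) (S.nodeRIn ℓ a.1 a.2)
        (nodeROut ℓ (S.gapOutZ Groot a.1 a.2))) (p₂ a) (q₂ a) ∧
      ¬ PathIn (openGraph ω) (zAnn (S.nodeCenter ((s : ℤ) + 1) ℓ x a.1) (S.nodeRIn ℓ a.1 a.2)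
        (nodeROut ℓ (S.gapOutZ Groot a.1 a.2))) (p₁ a) (p₂ a)) ∧
    (∀ i ∈ armIndex A Z Jz, zNorm (c i - S.nodeCenter ((s : ℤ) + 1) ℓ x i.1) < Necklace.armRIn R₀ K i.2 ∧
      ∃ q, (Necklace.armROut R₀ K i.2 : ℤ) ≤ zNorm (q - S.nodeCenter ((s : ℤ) + 1) ℓ x i.1) ∧
        PathIn (openGraph ω) (zBall x (2 * s)) (c i) q) ∧
    (∀ i ∈ armIndex A Z Jz, ∀ j ∈ armIndex A Z Jz, i ≠ j →
      ¬ PathIn (openGraph ω) (zBall x (2 * s)) (c i) (c j) ∨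
      Disjoint (zAnn (S.nodeCenter ((s : ℤ) + 1) ℓ x i.1) (Necklace.armRIn R₀ K i.2) (Necklace.armROut R₀ K i.2))
        (zAnn (S.nodeCenter ((s : ℤ) + 1) ℓ x j.1) (Necklace.armRIn R₀ K j.2) (Necklace.armROut R₀ K j.2))) ∧
    (∀ i ∈ armIndex A Z Jz, ∀ a ∈ S.goodNodes ℓ s M Groot,
      (¬ PathIn (openGraph ω) (zBall x (2 * s)) (c i) (p₁ a) ∧ ¬ PathIn (openGraph ω) (zBall x (2 * s)) (c i) (p₂ a)) ∨
      Disjoint (zAnn (S.nodeCenter ((s : ℤ) + 1) ℓ x i.1) (Necklace.armRIn R₀ K i.2) (Necklace.armROut R₀ K i.2))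
        (zAnn (S.nodeCenter ((s : ℤ) + 1) ℓ x a.1) (S.nodeRIn ℓ a.1 a.2) (nodeROut ℓ (S.gapOutZ Groot a.1 a.2))))}

/-! ## §4 The probability of the skeleton event -/

/-- Radii of a good node: `1 ≤ rIn ≤ ROut` (`M ≥ 48`, `ℓ ≥ 1`). -/
theorem goodNode_radii {ℓ s : ℕ} (hℓ : 1 ≤ ℓ) {M Groot : ℤ} (hM : 48 ≤ M) {q : ℕ × ℕ}
    (hq : q ∈ S.goodNodes ℓ s M Groot) :
    1 ≤ S.nodeRIn ℓ q.1 q.2 ∧ S.nodeRIn ℓ q.1 q.2 ≤ nodeROut ℓ (S.gapOutZ Groot q.1 q.2) ∧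
      8 ≤ S.gapOutZ Groot q.1 q.2 := by
  obtain ⟨h1, h2, -, hgood, -⟩ := S.mem_goodNodes.1 hq
  have hΔ0 : 0 ≤ S.t q.2 - S.t q.1 := by have := S.t_mono h1 h2; omega
  have hG : 48 * (S.t q.2 - S.t q.1 + 1) ≤ S.gapOutZ Groot q.1 q.2 := le_trans (by nlinarith) hgood
  set G := S.gapOutZ Groot q.1 q.2
  have hG8 : 0 ≤ G / 8 := by omega
  refine ⟨?_, ?_, by omega⟩
  · simp only [nodeRIn]
    nlinarith
  · rw [← Nat.cast_le (α := ℤ)]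
    simp only [nodeRIn, nodeROut]
    push_cast
    rw [Int.toNat_of_nonneg hΔ0, Int.toNat_of_nonneg hG8]
    have hℓ0 : (0 : ℤ) < ℓ := by exact_mod_cast hℓ
    have : 2 * (S.t q.2 - S.t q.1) + 3 ≤ G / 8 := by omega
    nlinarith

/-- **The probability of the skeleton event** is at most the product of the four-arm costs of the good nodes and the
one-arm costs of the claimed arms (`M ≥ 48`, `R₀ ≥ 2`, `K ≥ 1`, `(Nc - 1) ℓ < 8 (s + 1) ≤ Nc ℓ`). -/
theorem real_skelEvent_le : ∃ c ε C α : ℝ, 0 < c ∧ 0 < ε ∧ 0 < C ∧ 0 < α ∧ ∀ (Nc : ℤ) (S : CellSkeleton Nc)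
    (ℓ s : ℕ) (x : Site 2) (M Groot : ℤ) (R₀ K Jz : ℕ) (A : Finset ℕ) (Z : ℕ → Finset ℕ), 1 ≤ ℓ →
    8 * ((s : ℤ) + 1) ≤ Nc * ℓ → (Nc - 1) * (ℓ : ℤ) < 8 * ((s : ℤ) + 1) → 48 ≤ M → 2 ≤ R₀ → 1 ≤ K →
    (bondPercolation (zdGraph 2) half).real (S.skelEvent ℓ s x M Groot R₀ K Jz A Z) ≤
      (∏ a ∈ S.goodNodes ℓ s M Groot, c * ((S.nodeRIn ℓ a.1 a.2 : ℝ) / nodeROut ℓ (S.gapOutZ Groot a.1 a.2)) ^ (1 + ε)) *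
        ∏ i ∈ armIndex A Z Jz, C * ((Necklace.armRIn R₀ K i.2 : ℝ) /
          ((Necklace.armROut R₀ K i.2 - 1 : ℕ) : ℝ)) ^ α := by
  obtain ⟨c, ε, C, α, hc, hε, hC, hα, h⟩ := real_fourArm_and_armsIn_le
  refine ⟨c, ε, C, α, hc, hε, hC, hα, fun Nc S ℓ s x M Groot R₀ K Jz A Z hℓ hNc hNc' hM hR₀ hK ↦ ?_⟩
  have key := h (zBall x (2 * s)) (ℕ × ℕ) (ℕ × ℕ) (S.goodNodes ℓ s M Groot)
    (fun a ↦ S.nodeCenter ((s : ℤ) + 1) ℓ x a.1) (fun a ↦ S.nodeRIn ℓ a.1 a.2)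
    (fun a ↦ nodeROut ℓ (S.gapOutZ Groot a.1 a.2)) (armIndex A Z Jz)
    (fun i ↦ S.nodeCenter ((s : ℤ) + 1) ℓ x i.1) (fun i ↦ Necklace.armRIn R₀ K i.2)
    (fun i ↦ Necklace.armROut R₀ K i.2)
    (fun a ha ↦ ⟨(S.goodNode_radii hℓ hM ha).1, (S.goodNode_radii hℓ hM ha).2.1⟩)
    (fun a ha ↦ by
      obtain ⟨h1, h2, -, -, hRs⟩ := S.mem_goodNodes.1 ha
      refine Necklace.nodeAnnulus_subset S hℓ hNc' Groot (by omega) ?_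
      rw [← Nat.cast_le (α := ℤ)]
      have hG0 : 0 ≤ S.gapOutZ Groot a.1 a.2 / 8 := by
        have := (S.goodNode_radii hℓ hM ha).2.2; omega
      simp only [nodeROut]
      push_cast
      rw [Int.toNat_of_nonneg hG0]
      exact hRs)
    (fun a ha b hb hab ↦ by
      obtain ⟨h1, h2, hn, -, -⟩ := S.mem_goodNodes.1 ha
      obtain ⟨h1', h2', hn', -, -⟩ := S.mem_goodNodes.1 hb
      have hlam := GapHierarchy.isNode_laminar hn hn'
      exact S.nodeAnnulus_disjoint hℓ rfl (by omega) hNc hNc' Groot h1 h2 h1' h2'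
        (fun heq ↦ hab (Prod.ext_iff.2 (Prod.ext_iff.1 heq))) hlam (S.goodNode_radii hℓ hM ha).2.2
        (S.goodNode_radii hℓ hM hb).2.2)
    (fun i _ ↦ Necklace.armRIn_le hR₀ hK i.2)
  exact key

end CellSkeleton

namespace SkelData

/-- **The skeleton event of raw data**: the event of its cell skeleton if the data are valid, else empty. -/
def skelEvent (Nc : ℤ) (ℓ s : ℕ) (x : Site 2) (M Groot : ℤ) (R₀ K Jz : ℕ) (d : SkelData) :
    Set (BondConfig (Site 2)) :=
  ⋃ (h : d.Valid Nc), (d.toCellSkeleton h).skelEvent ℓ s x M Groot R₀ K Jz d.A d.Z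

end SkelData

end NeckCoarseZ2

/-- **Probability of the skeleton event (registered helper, anchor of this module on the crux item)**: the event of a
cell skeleton with good nodes (threshold `M ≥ 48`) and claimed arm slots (`R₀ ≥ 2`, `K ≥ 1`) has probability at
most the product of the four-arm costs `c (rIn/ROut)^{1+ε}` of the good nodes and the one-arm costs
`C (armRIn/(armROut - 1))^α` of the claimed arms (`CellSkeleton.real_skelEvent_le`, an instance of
`real_fourArm_and_armsIn_le`). -/
theorem skeleton_event_bound : ∃ c ε C α : ℝ, 0 < c ∧ 0 < ε ∧ 0 < C ∧ 0 < α ∧ ∀ (Nc : ℤ) (S : NeckCoarseZ2.CellSkeleton Nc) (ℓ s : ℕ) (x : Site 2) (M Groot : ℤ) (R₀ K Jz : ℕ) (A : Finset ℕ) (Z : ℕ → Finset ℕ), 1 ≤ ℓ → 8 * ((s : ℤ) + 1) ≤ Nc * ℓ → (Nc - 1) * (ℓ : ℤ) < 8 * ((s : ℤ) + 1) → 48 ≤ M → 2 ≤ R₀ → 1 ≤ K → (bondPercolation (zdGraph 2) half).real (S.skelEvent ℓ s x M Groot R₀ K Jz A Z) ≤ (∏ a ∈ S.goodNodes ℓ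 s M Groot, c * ((S.nodeRIn ℓ a.1 a.2 : ℝ) / NeckCoarseZ2.CellSkeleton.nodeROut ℓ (S.gapOutZ Groot a.1 a.2)) ^ (1 + ε)) * ∏ i ∈ NeckCoarseZ2.CellSkeleton.armIndex A Z Jz, C * ((Necklace.armRIn R₀ K i.2 : ℝ) / ((Necklace.armROut R₀ K i.2 - 1 : ℕ) : ℝ)) ^ α :=
  NeckCoarseZ2.CellSkeleton.real_skelEvent_le

end Summit.CriticalPhenomena.CardyFormulaZ2.Cruxes.NestingRigidity.PinchResampling

end
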